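import Literature.NumberTheory.Transcendental.CurvePeriodsGmBakerProofs
import Mathlib.FieldTheory.Separable
import Mathlib.LinearAlgebra.Lagrange
import Mathlib.Algebra.Polynomial.Div
import HarnessLib

/-!
# Periods of curve type: Huber–Wüstholz 13.3 (2) in genus `0` (punctured lines) from Baker

Companion of `Literature/NumberTheory/Transcendental/CurvePeriods.lean` (Huber–Wüstholz 2022,
Thm. 13.3 (2), rendered on explicit period symbols with the elementary relations (R1)–(R5)).
`CurvePeriodsGmBakerProofs.lean` settles the symbols on `𝔾ₘ` and `𝔸¹`; this file settles ALL
smooth affine curves of genus `0` over `ℚ̄` in their standard embeddings, the punctured lines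
`𝔸¹ ∖ {a₁, …, a_r} ≅ Z_a = {(x, y) ∈ 𝔸² | y · ∏ᵢ (x − aᵢ) = 1}` (`aᵢ ∈ ℚ̄` pairwise distinct),
with arbitrary `C¹` paths with algebraic end points (and, by transport, every curve polynomially
isomorphic to one of them):

* `huberWustholzCurvePeriods_of_puncturedLine` — a vanishing `ℚ̄`-linear combination of period
  symbols on punctured lines `Z_a`, on `𝔾ₘ` and on `𝔸¹` is a `ℚ̄`-linear combination of
  elementary relations.

The periods in question are the `ℚ̄`-combinations of `1` and of logarithms of algebraic numbers
(`∫_γ dx/(x − aᵢ)`), so this is again Baker's theorem (book, Rem. 15.11; §10.1), which is proved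
in the tree (`Literature.NumberTheory.Transcendental.baker_holds`). The new input is the algebraic
de Rham reduction on `Z_a` (the book's §3.3.1 made explicit: `H¹_dR(𝔸¹ ∖ {aᵢ})` is spanned by the
classes of `dx/(x − aᵢ) = y ∏_{j ≠ i} (x − aⱼ) dx`): every polynomial form `ω` on `Z_a` over `ℚ̄`
is `Σᵢ cᵢ · y Pᵢ dx + dQ + ν` with `cᵢ ∈ ℚ̄` (residues), `Q ∈ ℚ̄[x, y]`, `ν` vanishing on `Z_a`
(`exists_reduction_form_punctured`; division with remainder, Lagrange interpolation at the `aᵢ`,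
and Bézout `u p + v p′ = 1` for the separable `p = ∏ (x − aᵢ)` to lower the order of the pole),
and the functoriality (R4) along `fᵢ = (x − aᵢ, y Pᵢ) : Z_a → 𝔾ₘ`, `fᵢ^*(y dx) = y Pᵢ dx`, which
turns every symbol on `Z_a` into logarithm symbols on `𝔾ₘ` plus a multiple of `𝟙`; then
`huberWustholzCurvePeriods_of_mulGroup_affineLine` applies to the transferred combination.

## References

* A. Huber, G. Wüstholz, *Transcendence and Linear Relations of 1-Periods*, Cambridge Tracts in
  Mathematics 227, CUP 2022 [HuberWustholz2022], Thm. 13.3 (2) (p. 121 of the held text),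
  §3.3.1 (pp. 42–43), §10.1 (p. 96), Rem. 15.11 (p. 151).
* A. Baker, *Transcendental Number Theory*, CUP 1975, Thm. 2.1 (`baker_holds`).
-/

noncomputable section

open scoped BigOperators Real Polynomial
open MvPolynomial Set Complex

namespace Literature.NumberTheory.Transcendental

namespace CurvePeriods

section PuncturedLine

local notation3 "InSpanRel " c:arg => ∃ (k : ℕ) (ρ : Fin k → (PeriodSymbol →₀ ℂ))
  (a : Fin k → ℂ), (∀ l, IsElementaryRelation (ρ l)) ∧ (∀ l, IsAlgebraic ℚ (a l)) ∧
    c = ∑ l, a l • ρ l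

-- The punctured line `Z_a = {(x, y) | y · ∏ᵢ (x − aᵢ) = 1} ⊂ 𝔸²` (`≅ 𝔸¹ ∖ {a₁, …, a_r}`).
local notation3 (prettyPrint := false) "ZP " a:arg =>
  (⟨2, 1, ![X 1 * ∏ i, (X 0 - C (a i)) - 1]⟩ : CurveData)

variable {r : ℕ}

/-! ### Generic vanishing forms -/

/-- A form all of whose coefficients vanish at the points of `Z` vanishes on `Z`. [folklore] -/
theorem vanishesOn_of_eval_eq_zero (Z : CurveData) (ν : Fin Z.n → MvPolynomial (Fin Z.n) ℂ)
    (h : ∀ z ∈ Z.points, ∀ i, eval z (ν i) = 0) : VanishesOn Z ν := by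
  intro z hz v _
  exact Finset.sum_eq_zero fun i _ => by rw [h z hz i, zero_mul]

/-- The differential `dFⱼ` of an equation of `Z`, multiplied by any polynomial, vanishes on `Z`
(this is the definition of the tangent space). [folklore] -/
theorem vanishesOn_mul_formD_F (Z : CurveData) (j : Fin Z.m) (Q : MvPolynomial (Fin Z.n) ℂ) :
    VanishesOn Z (fun i => Q * formD (Z.F j) i) := by
  intro z _ v hv
  have e : (∑ i, eval z (Q * formD (Z.F j) i) * v i) =
      eval z Q * ∑ i, Z.gradient j z i * v i := by
    rw [Finset.mul_sum]
    exact Finset.sum_congr rfl fun i _ => by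
      simp only [formD, CurveData.gradient, map_mul]; ring
  rw [e, hv j, mul_zero]

/-! ### The punctured line `Z_a` -/

/-- The polynomial `p_a(x) = ∏ᵢ (x − aᵢ)` as a function. [folklore] -/
theorem eval_prod_X_sub_C (a : Fin r → ℂ) (z : Fin 2 → ℂ) :
    eval z (∏ i, (X 0 - C (a i)) : MvPolynomial (Fin 2) ℂ) = ∏ i, (z 0 - a i) := by
  rw [map_prod]
  exact Finset.prod_congr rfl fun i _ => by simp

/-- Membership in `Z_a`: `z₁ · ∏ᵢ (z₀ − aᵢ) = 1`. [folklore] -/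
theorem mem_points_puncturedLine_iff (a : Fin r → ℂ) (z : Fin 2 → ℂ) :
    z ∈ (ZP a).points ↔ z 1 * ∏ i, (z 0 - a i) = 1 := by
  refine (CurveData.mem_points (Z := ZP a) (z := z)).trans ?_
  simp only [Fin.forall_fin_one, Matrix.cons_val_fin_one, map_sub, map_mul, eval_X, map_one,
    eval_prod_X_sub_C, sub_eq_zero]

/-- `∂/∂y` kills polynomials in `x`: `∂_y ∏ᵢ (x − aᵢ) = 0`. [folklore] -/
theorem pderiv_one_prod_X_sub_C (a : Fin r → ℂ) (S : Finset (Fin r)) :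
    pderiv 1 (∏ i ∈ S, (X 0 - C (a i)) : MvPolynomial (Fin 2) ℂ) = 0 := by
  refine Finset.prod_induction _ (fun F : MvPolynomial (Fin 2) ℂ => pderiv 1 F = 0)
    (fun F G hF hG => ?_) (by simp) (fun i _ => ?_)
  · rw [Derivation.leibniz, hF, hG, smul_zero, smul_zero, add_zero]
  · simp [pderiv_X]

/-- The equation `F = y · p_a(x) − 1` of `Z_a` has `∂F/∂x = y · p_a′(x)` and `∂F/∂y = p_a(x)`.
[folklore] -/
theorem formD_F_puncturedLine (a : Fin r → ℂ) :
    formD ((ZP a).F 0) = ![X 1 * pderiv 0 (∏ i, (X 0 - C (a i)) : MvPolynomial (Fin 2) ℂ),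
      ∏ i, (X 0 - C (a i))] := by
  funext i
  simp only [formD, Matrix.cons_val_fin_one]
  fin_cases i
  · simp [Derivation.leibniz, pderiv_X]
  · simp [Derivation.leibniz, pderiv_X, pderiv_one_prod_X_sub_C]

/-- The gradient of the equation of `Z_a` at `z`: `(z₁ p_a′(z₀), p_a(z₀))`. [folklore] -/
theorem gradient_puncturedLine (a : Fin r → ℂ) (z : Fin 2 → ℂ) :
    (ZP a).gradient 0 z = ![z 1 * eval z (pderiv 0 (∏ i, (X 0 - C (a i)) :
      MvPolynomial (Fin 2) ℂ)), ∏ i, (z 0 - a i)] := by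
  funext i
  have h := congrFun (formD_F_puncturedLine a) i
  simp only [formD] at h
  simp only [CurveData.gradient]
  rw [h]
  fin_cases i
  · simp
  · simp

/-- The equations of `Z_a` are over `ℚ̄` when the `aᵢ` are algebraic. [folklore] -/
theorem hasAlgCoeffs_prod_X_sub_C {a : Fin r → ℂ} (ha : ∀ i, IsAlgebraic ℚ (a i)) :
    HasAlgCoeffs (∏ i, (X 0 - C (a i)) : MvPolynomial (Fin 2) ℂ) :=
  hasAlgCoeffs_finsetProd _ _ fun i _ => (hasAlgCoeffs_X 0).sub (hasAlgCoeffs_C (ha i))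

/-- **The punctured line `Z_a = {y ∏ᵢ (x − aᵢ) = 1} ⊂ 𝔸²` is a smooth affine curve over `ℚ̄`**
(for algebraic `aᵢ`): the gradient `(y p′(x), p(x))` does not vanish on `Z_a` (`p(x) y = 1`), and
no point is isolated (`x ↦ (x, 1/p(x))` parametrises `Z_a` near every point).
[cite: HuberWustholz2022, §3.3.1 (pp. 42–43), §10.1 (p. 96)] -/
theorem isSmoothAffineCurve_puncturedLine {a : Fin r → ℂ} (ha : ∀ i, IsAlgebraic ℚ (a i)) :
    (ZP a).IsSmoothAffineCurve where
  algebraic j := by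
    fin_cases j
    simpa using ((hasAlgCoeffs_X (n := 2) 1).mul (hasAlgCoeffs_prod_X_sub_C ha)).sub
      hasAlgCoeffs_one
  rank_eq z hz := by
    rw [mem_points_puncturedLine_iff] at hz
    have hp0 : ∏ i, (z 0 - a i) ≠ 0 := right_ne_zero_of_mul_eq_one hz
    have hrange : (Set.range fun j : Fin 1 => (ZP a).gradient j z) =
        {(ZP a).gradient 0 z} := by
      rw [Set.range_unique]
      rfl
    rw [hrange]
    have hv : (ZP a).gradient 0 z ≠ 0 := by
      intro h
      have := congrFun h 1
      rw [gradient_puncturedLine] at this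
      simp only [Matrix.cons_val_one, Matrix.cons_val_fin_one, Pi.zero_apply] at this
      exact hp0 this
    exact finrank_span_singleton hv
  not_isolated z hz := by
    rw [mem_points_puncturedLine_iff] at hz
    have hp0 : ∏ i, (z 0 - a i) ≠ 0 := right_ne_zero_of_mul_eq_one hz
    have hz1 : z 1 = (∏ i, (z 0 - a i))⁻¹ := eq_inv_of_mul_eq_one_left hz
    -- the parametrisation `u ↦ (z₀ + u, 1 / p(z₀ + u))`, `u ∈ ℝ` small, `u ≠ 0`
    set pf : ℂ → ℂ := fun x => ∏ i, (x - a i) with hpf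
    have hpc : Continuous pf := by
      rw [hpf]
      exact continuous_finsetProd _ fun i _ => continuous_id.sub continuous_const
    set f : ℝ → (Fin 2 → ℂ) := fun u => ![z 0 + u, (pf (z 0 + u))⁻¹] with hf
    have hlin : Continuous fun u : ℝ => z 0 + (u : ℂ) := continuous_const.add continuous_ofReal
    have hpf0 : pf (z 0 + ((0 : ℝ) : ℂ)) ≠ 0 := by simpa [hpf] using hp0
    have hfc : ContinuousAt f 0 := by
      rw [hf]
      refine continuousAt_pi.2 fun i => ?_
      fin_cases i
      · exact hlin.continuousAt
      · exact ((hpc.continuousAt.comp hlin.continuousAt).inv₀ hpf0)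
    have hf0 : f 0 = z := by
      funext i
      fin_cases i
      · simp [hf]
      · simp [hf, hz1, hpf]
    refine mem_closure_of_tendsto (b := nhdsWithin (0 : ℝ) {0}ᶜ) (f := f) ?_ ?_
    · have h := (hfc.tendsto).mono_left (nhdsWithin_le_nhds (s := {(0 : ℝ)}ᶜ))
      rwa [hf0] at h
    · -- eventually `p(z₀ + u) ≠ 0`, so `f u ∈ Z_a`, and `f u ≠ z` for `u ≠ 0`
      have hev : ∀ᶠ u : ℝ in nhds 0, pf (z 0 + u) ≠ 0 :=
        (hpc.continuousAt.comp hlin.continuousAt).eventually_ne hpf0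
      have hev' := hev.filter_mono (nhdsWithin_le_nhds (s := {(0 : ℝ)}ᶜ))
      filter_upwards [hev', self_mem_nhdsWithin] with u hu hu0
      refine ⟨(mem_points_puncturedLine_iff a _).2 ?_, ?_⟩
      · simp only [hf, Matrix.cons_val_one, Matrix.cons_val_fin_one, Matrix.cons_val_zero]
        exact inv_mul_cancel₀ hu
      · intro h
        have h0 := congrFun h 0
        simp only [hf, Matrix.cons_val_zero, add_eq_left, ofReal_eq_zero] at h0
        exact hu0 h0

/-! ### Polynomials in `x` over `ℚ̄`: the bridge `ℚ̄[X] → ℂ[x, y]` -/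

-- The field `ℚ̄ ⊂ ℂ` of algebraic numbers, as an intermediate field (a type).
local notation3 (prettyPrint := false) "𝕂" => (↥(algebraicClosure ℚ ℂ))

-- The embedding `ι : ℚ̄[X] → ℂ[x, y]`, `X ↦ x` (a ring homomorphism).
local notation3 (prettyPrint := false) "ι" =>
  ((Polynomial.aeval (R := ℂ) (X 0 : MvPolynomial (Fin 2) ℂ)).toRingHom.comp
    (Polynomial.mapRingHom (algebraMap (↥(algebraicClosure ℚ ℂ)) ℂ)))

/-- `ι` on constants. [folklore] -/
theorem iota_C (c : 𝕂) : ι (Polynomial.C c) = C (c : ℂ) := by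
  simp [MvPolynomial.algebraMap_eq]

/-- `ι X = x`. [folklore] -/
theorem iota_X : ι Polynomial.X = (X 0 : MvPolynomial (Fin 2) ℂ) := by
  simp

/-- `ι` takes values in polynomials over `ℚ̄`. [folklore] -/
theorem hasAlgCoeffs_iota (f : 𝕂[X]) : HasAlgCoeffs (ι f) := by
  induction f using Polynomial.induction_on with
  | C c =>
    rw [iota_C]
    exact hasAlgCoeffs_C (mem_algebraicClosure_iff.1 c.2)
  | add f g hf hg => rw [map_add]; exact hf.add hg
  | monomial n c h =>
    rw [map_mul, map_pow, iota_X]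
    rw [map_mul, map_pow, iota_X] at h
    simpa [pow_succ, ← mul_assoc] using h.mul (hasAlgCoeffs_X 0)

/-- `∂/∂x ∘ ι = ι ∘ d/dX`. [folklore] -/
theorem pderiv_zero_iota (f : 𝕂[X]) : pderiv 0 (ι f) = ι (Polynomial.derivative f) := by
  induction f using Polynomial.induction_on with
  | C c => rw [iota_C, Polynomial.derivative_C, map_zero, pderiv_C]
  | add f g hf hg => rw [map_add, map_add, map_add, map_add, hf, hg]
  | monomial n c h =>
    have e : Polynomial.derivative (Polynomial.C c * Polynomial.X ^ n * Polynomial.X) =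
        Polynomial.derivative (Polynomial.C c * Polynomial.X ^ n) * Polynomial.X +
          Polynomial.C c * Polynomial.X ^ n := by
      rw [Polynomial.derivative_mul, Polynomial.derivative_X, mul_one]
    rw [pow_succ, ← mul_assoc, e]
    simp only [map_add, map_mul, iota_X] at h ⊢
    rw [Derivation.leibniz, smul_eq_mul, smul_eq_mul, pderiv_X_self, mul_one, h]
    ring

/-- `∂/∂y ∘ ι = 0`. [folklore] -/
theorem pderiv_one_iota (f : 𝕂[X]) : pderiv 1 (ι f) = 0 := by
  induction f using Polynomial.induction_on with
  | C c => rw [iota_C, pderiv_C]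
  | add f g hf hg => rw [map_add, map_add, hf, hg, add_zero]
  | monomial n c h =>
    rw [pow_succ, ← mul_assoc, map_mul, iota_X, Derivation.leibniz, h, pderiv_X]
    simp

/-- Evaluation: `(ι f)(z) = f(z₀)`. [folklore] -/
theorem eval_iota (f : 𝕂[X]) (z : Fin 2 → ℂ) :
    eval z (ι f) = Polynomial.eval (z 0) (f.map (algebraMap 𝕂 ℂ)) := by
  induction f using Polynomial.induction_on with
  | C c => rw [iota_C, Polynomial.map_C, Polynomial.eval_C, eval_C]; rfl
  | add f g hf hg => rw [map_add, map_add, Polynomial.map_add, Polynomial.eval_add, hf, hg]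
  | monomial n c h =>
    rw [pow_succ, ← mul_assoc, Polynomial.map_mul, Polynomial.map_X, Polynomial.eval_mul_X,
      map_mul, iota_X, map_mul, eval_X, h]

/-- `ι (∏ (X − aᵢ)) = ∏ (x − aᵢ)`. [folklore] -/
theorem iota_prod_X_sub_C {ι' : Type*} (S : Finset ι') (a' : ι' → 𝕂) :
    ι (∏ i ∈ S, (Polynomial.X - Polynomial.C (a' i))) =
      ∏ i ∈ S, (X 0 - C ((a' i : ℂ)) : MvPolynomial (Fin 2) ℂ) := by
  rw [map_prod]
  exact Finset.prod_congr rfl fun i _ => by rw [map_sub, iota_X, iota_C]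

/-! ### One-variable algebra over `ℚ̄` -/

/-- Antiderivatives exist in `ℚ̄[X]`. [folklore] -/
theorem exists_derivative_eq (f : 𝕂[X]) : ∃ F : 𝕂[X], Polynomial.derivative F = f := by
  induction f using Polynomial.induction_on' with
  | add f g hf hg =>
    obtain ⟨F, hF⟩ := hf
    obtain ⟨G, hG⟩ := hg
    exact ⟨F + G, by rw [map_add, hF, hG]⟩
  | monomial n c =>
    refine ⟨Polynomial.monomial (n + 1) (c / (n + 1)), ?_⟩
    rw [Polynomial.derivative_monomial]
    have hn : ((n : 𝕂) + 1) ≠ 0 := Nat.cast_add_one_ne_zero n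
    simp only [Nat.cast_add, Nat.cast_one, add_tsub_cancel_right]
    rw [div_mul_cancel₀ c hn]

/-- **Lagrange interpolation at distinct nodes**: a polynomial of degree `< r` is a
`ℚ̄`-combination of the `∏_{j ≠ i} (X − aⱼ)`. [folklore] -/
theorem exists_eq_sum_C_mul_prod_erase {a' : Fin r → 𝕂} (hinj : Function.Injective a')
    (s : 𝕂[X]) (hs : s.degree < r) :
    ∃ c : Fin r → 𝕂, s = ∑ i, Polynomial.C (c i) *
      ∏ j ∈ Finset.univ.erase i, (Polynomial.X - Polynomial.C (a' j)) := by
  classical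
  have hvs : Set.InjOn a' (Finset.univ : Finset (Fin r)) := hinj.injOn
  have hdeg : s.degree < (Finset.univ : Finset (Fin r)).card := by simpa using hs
  have h := Lagrange.eq_interpolate hvs hdeg
  refine ⟨fun i => s.eval (a' i) * ∏ j ∈ Finset.univ.erase i, (a' i - a' j)⁻¹, ?_⟩
  conv_lhs => rw [h]
  rw [Lagrange.interpolate_apply]
  refine Finset.sum_congr rfl fun i _ => ?_
  rw [Lagrange.basis]
  simp only [Lagrange.basisDivisor]
  rw [Finset.prod_mul_distrib, ← map_prod, ← mul_assoc, ← map_mul]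

/-- **Bézout for the separable polynomial `p = ∏ (X − aᵢ)`** (distinct `aᵢ`):
`u p + v p′ = 1`. [folklore] -/
theorem exists_bezout_prod_X_sub_C {a' : Fin r → 𝕂} (hinj : Function.Injective a') :
    ∃ u v : 𝕂[X], u * ∏ i, (Polynomial.X - Polynomial.C (a' i)) +
      v * Polynomial.derivative (∏ i, (Polynomial.X - Polynomial.C (a' i))) = 1 :=
  (Polynomial.separable_def' _).1 (Polynomial.separable_prod_X_sub_C_iff.2 hinj)

/-! ### Reduction of polynomial 1-forms on `Z_a`: the target shape and its closure properties

`Red[a] g` says: `g dx = Σᵢ cᵢ · y Pᵢ dx + dQ + ν` on `Z_a` with `cᵢ ∈ ℚ̄`, `Q ∈ ℚ̄[x, y]`, `ν` over `ℚ̄`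
vanishing on `Z_a`, where `Pᵢ = ∏_{j ≠ i} (x − aⱼ)` (so that `y Pᵢ dx = dx/(x − aᵢ)` on `Z_a`). -/

local notation3 (prettyPrint := false) "Red[" a "] " g:arg =>
  (∃ (c : Fin _ → ℂ) (Q : MvPolynomial (Fin 2) ℂ) (ν : Fin 2 → MvPolynomial (Fin 2) ℂ),
      (∀ i, IsAlgebraic ℚ (c i)) ∧ HasAlgCoeffs Q ∧ (∀ i, HasAlgCoeffs (ν i)) ∧
        VanishesOn (ZP a) ν ∧
        (![g, 0] : Fin 2 → MvPolynomial (Fin 2) ℂ) =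
          ∑ i, c i • (![X 1 * ∏ j ∈ Finset.univ.erase i, (X 0 - C (a j)), 0] :
            Fin 2 → MvPolynomial (Fin 2) ℂ) + formD Q + ν)

section Reduction

variable {a : Fin r → ℂ}

/-- Two-component vector bookkeeping. [folklore] -/
theorem vec2_eq_iff (u v : Fin 2 → MvPolynomial (Fin 2) ℂ) : u = v ↔ u 0 = v 0 ∧ u 1 = v 1 := by
  constructor
  · rintro rfl; exact ⟨rfl, rfl⟩
  · rintro ⟨h0, h1⟩
    funext i
    fin_cases i
    · exact h0
    · exact h1

/-- Components of the normal form `Σᵢ cᵢ · (y Pᵢ, 0)`. [folklore] -/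
theorem sum_smul_vec_apply (c : Fin r → ℂ) (G : Fin r → MvPolynomial (Fin 2) ℂ) :
    (∑ i, c i • (![G i, 0] : Fin 2 → MvPolynomial (Fin 2) ℂ)) 0 = ∑ i, c i • G i ∧
      (∑ i, c i • (![G i, 0] : Fin 2 → MvPolynomial (Fin 2) ℂ)) 1 = 0 := by
  constructor
  · rw [Finset.sum_apply]
    exact Finset.sum_congr rfl fun i _ => by simp
  · rw [Finset.sum_apply]
    exact Finset.sum_eq_zero fun i _ => by simp

/-- `Red[a] 0`. [folklore] -/
theorem red_zero : Red[a] (0 : MvPolynomial (Fin 2) ℂ) := by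
  refine ⟨0, 0, 0, fun _ => isAlgebraic_zero, hasAlgCoeffs_zero,
    fun i => by simpa using (hasAlgCoeffs_zero (n := 2)), VanishesOn.zero _, ?_⟩
  rw [formD_zero, add_zero, add_zero]
  rw [vec2_eq_iff]
  refine ⟨?_, ?_⟩
  · rw [(sum_smul_vec_apply _ _).1]; simp
  · rw [(sum_smul_vec_apply _ _).2]; simp

/-- `Red[a]` is additive. [folklore] -/
theorem red_add {g₁ g₂ : MvPolynomial (Fin 2) ℂ} (h₁ : Red[a] g₁) (h₂ : Red[a] g₂) :
    Red[a] (g₁ + g₂) := by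
  obtain ⟨c₁, Q₁, ν₁, hc₁, hQ₁, hν₁, hv₁, he₁⟩ := h₁
  obtain ⟨c₂, Q₂, ν₂, hc₂, hQ₂, hν₂, hv₂, he₂⟩ := h₂
  refine ⟨c₁ + c₂, Q₁ + Q₂, ν₁ + ν₂, fun i => (hc₁ i).add (hc₂ i), hQ₁.add hQ₂,
    fun i => (hν₁ i).add (hν₂ i), hv₁.add hv₂, ?_⟩
  have hvec : (![g₁ + g₂, 0] : Fin 2 → MvPolynomial (Fin 2) ℂ) = ![g₁, 0] + ![g₂, 0] := by
    rw [vec2_eq_iff]; simp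
  have hsum : ∑ i, (c₁ + c₂) i • (![X 1 * ∏ j ∈ Finset.univ.erase i, (X 0 - C (a j)), 0] :
      Fin 2 → MvPolynomial (Fin 2) ℂ) =
      ∑ i, c₁ i • (![X 1 * ∏ j ∈ Finset.univ.erase i, (X 0 - C (a j)), 0] :
        Fin 2 → MvPolynomial (Fin 2) ℂ) +
      ∑ i, c₂ i • (![X 1 * ∏ j ∈ Finset.univ.erase i, (X 0 - C (a j)), 0] :
        Fin 2 → MvPolynomial (Fin 2) ℂ) := by
    rw [← Finset.sum_add_distrib]
    exact Finset.sum_congr rfl fun i _ => by rw [Pi.add_apply, add_smul]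
  rw [hvec, he₁, he₂, hsum, formD_add]
  abel

/-- `Red[a]` is stable under algebraic scalars. [folklore] -/
theorem red_C_mul {g : MvPolynomial (Fin 2) ℂ} {m : ℂ} (hm : IsAlgebraic ℚ m) (h : Red[a] g) :
    Red[a] (C m * g) := by
  obtain ⟨c, Q, ν, hc, hQ, hν, hv, he⟩ := h
  refine ⟨fun i => m * c i, C m * Q, m • ν, fun i => hm.mul (hc i), (hasAlgCoeffs_C hm).mul hQ,
    fun i => (hν i).smul hm, hv.smul m, ?_⟩
  have hvec : (![C m * g, 0] : Fin 2 → MvPolynomial (Fin 2) ℂ) = m • ![g, 0] := by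
    rw [vec2_eq_iff]; simp [smul_eq_C_mul]
  have hsum : ∑ i, (m * c i) • (![X 1 * ∏ j ∈ Finset.univ.erase i, (X 0 - C (a j)), 0] :
      Fin 2 → MvPolynomial (Fin 2) ℂ) =
      m • ∑ i, c i • (![X 1 * ∏ j ∈ Finset.univ.erase i, (X 0 - C (a j)), 0] :
        Fin 2 → MvPolynomial (Fin 2) ℂ) := by
    rw [Finset.smul_sum]
    exact Finset.sum_congr rfl fun i _ => by rw [smul_smul]
  rw [hvec, he, hsum, formD_C_mul, smul_add, smul_add]

/-- `Red[a]` is stable under finite sums. [folklore] -/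
theorem red_sum {ι' : Type*} (S : Finset ι') (g : ι' → MvPolynomial (Fin 2) ℂ)
    (h : ∀ i ∈ S, Red[a] (g i)) : Red[a] (∑ i ∈ S, g i) := by
  classical
  induction S using Finset.induction_on with
  | empty => simpa using (red_zero (a := a))
  | insert i S hi ih =>
    rw [Finset.sum_insert hi]
    exact red_add (h i (Finset.mem_insert_self i S))
      (ih fun j hj => h j (Finset.mem_insert_of_mem hj))

/-- `Red[a]` only depends on `g|_{Z_a}` (for `g` over `ℚ̄`). [folklore] -/
theorem red_congr {g g' : MvPolynomial (Fin 2) ℂ} (h' : Red[a] g') (hg : HasAlgCoeffs g)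
    (hg' : HasAlgCoeffs g') (heq : ∀ z ∈ (ZP a).points, eval z g = eval z g') : Red[a] g := by
  obtain ⟨c, Q, ν, hc, hQ, hν, hv, he⟩ := h'
  refine ⟨c, Q, ν + ![g - g', 0], hc, hQ, fun i => ?_,
    hv.add (vanishesOn_of_eval_eq_zero _ _ fun z hz i => ?_), ?_⟩
  · fin_cases i
    · simpa using (hν 0).add (hg.sub hg')
    · simpa using hν 1
  · fin_cases i
    · simp [heq z hz]
    · simp
  · have hvec : (![g, 0] : Fin 2 → MvPolynomial (Fin 2) ℂ) = ![g', 0] + ![g - g', 0] := by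
      rw [vec2_eq_iff]; simp
    rw [hvec, he]
    abel

/-- `Red[a]` through an identity `m · (g, 0) = (g′, 0) + dT + ν₂`. [folklore] -/
theorem red_of_smul_eq {g g' T : MvPolynomial (Fin 2) ℂ} {m : ℂ}
    {ν₂ : Fin 2 → MvPolynomial (Fin 2) ℂ} (h' : Red[a] g') (hm0 : m ≠ 0)
    (hm : IsAlgebraic ℚ m) (hT : HasAlgCoeffs T) (hν₂ : ∀ i, HasAlgCoeffs (ν₂ i))
    (hv₂ : VanishesOn (ZP a) ν₂)
    (heq : m • (![g, 0] : Fin 2 → MvPolynomial (Fin 2) ℂ) = ![g', 0] + formD T + ν₂) :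
    Red[a] g := by
  obtain ⟨c, Q, ν, hc, hQ, hν, hv, he⟩ := h'
  refine ⟨fun i => m⁻¹ * c i, C m⁻¹ * (Q + T), m⁻¹ • (ν + ν₂), fun i => hm.inv.mul (hc i),
    (hasAlgCoeffs_C hm.inv).mul (hQ.add hT), fun i => ((hν i).add (hν₂ i)).smul hm.inv,
    (hv.add hv₂).smul _, ?_⟩
  have h1 : (![g, 0] : Fin 2 → MvPolynomial (Fin 2) ℂ) =
      m⁻¹ • (m • (![g, 0] : Fin 2 → MvPolynomial (Fin 2) ℂ)) := by
    rw [smul_smul, inv_mul_cancel₀ hm0, one_smul]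
  have hsum : ∑ i, (m⁻¹ * c i) • (![X 1 * ∏ j ∈ Finset.univ.erase i, (X 0 - C (a j)), 0] :
      Fin 2 → MvPolynomial (Fin 2) ℂ) =
      m⁻¹ • ∑ i, c i • (![X 1 * ∏ j ∈ Finset.univ.erase i, (X 0 - C (a j)), 0] :
        Fin 2 → MvPolynomial (Fin 2) ℂ) := by
    rw [Finset.smul_sum]
    exact Finset.sum_congr rfl fun i _ => by rw [smul_smul]
  rw [h1, heq, he, hsum, formD_C_mul, formD_add]
  simp only [smul_add]
  abel

/-- The tangent space of `Z_a` at `z`: `z₁ p′(z₀) v₀ + p(z₀) v₁ = 0`. [folklore] -/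
theorem mem_tangentSpace_puncturedLine_iff (a : Fin r → ℂ) (z v : Fin 2 → ℂ) :
    v ∈ (ZP a).tangentSpace z ↔
      z 1 * eval z (pderiv 0 (∏ i, (X 0 - C (a i)) : MvPolynomial (Fin 2) ℂ)) * v 0 +
        (∏ i, (z 0 - a i)) * v 1 = 0 := by
  simp only [CurveData.tangentSpace, mem_setOf_eq, Fin.forall_fin_one, Fin.sum_univ_two]
  rw [show (0 : Fin (ZP a).m) = (0 : Fin 1) from rfl, gradient_puncturedLine]
  simp

/-- **Elimination of `dy` on `Z_a`**: the forms `G y² p′(x) dx + G dy` vanish on `Z_a`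
(`d(y p(x)) = 0` and `y p(x) = 1` on `Z_a`, so `dy = −y² p′(x) dx`). [folklore] -/
theorem vanishesOn_puncturedLine_dy (a : Fin r → ℂ) (G : MvPolynomial (Fin 2) ℂ) :
    VanishesOn (ZP a) (![G * X 1 ^ 2 * pderiv 0 (∏ i, (X 0 - C (a i)) : MvPolynomial (Fin 2) ℂ),
      G] : Fin 2 → MvPolynomial (Fin 2) ℂ) := by
  intro z hz v hv
  rw [mem_points_puncturedLine_iff] at hz
  rw [mem_tangentSpace_puncturedLine_iff] at hv
  simp only [Fin.sum_univ_two, Matrix.cons_val_zero, Matrix.cons_val_one, map_mul, map_pow,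
    eval_X, Matrix.cons_val_fin_one]
  have key : z 1 ^ 2 * eval z (pderiv 0 (∏ i, (X 0 - C (a i)) : MvPolynomial (Fin 2) ℂ)) * v 0 +
      v 1 = z 1 * (z 1 * eval z (pderiv 0 (∏ i, (X 0 - C (a i)) : MvPolynomial (Fin 2) ℂ)) * v 0 +
        (∏ i, (z 0 - a i)) * v 1) := by
    linear_combination (-(v 1)) * hz
  linear_combination eval z G * key + eval z G * z 1 * hv

/-- The `dy`-elimination forms are over `ℚ̄`. [folklore] -/
theorem hasAlgCoeffs_dy (ha : ∀ i, IsAlgebraic ℚ (a i)) {G : MvPolynomial (Fin 2) ℂ}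
    (hG : HasAlgCoeffs G) : ∀ i, HasAlgCoeffs ((![G * X 1 ^ 2 *
      pderiv 0 (∏ i, (X 0 - C (a i)) : MvPolynomial (Fin 2) ℂ), G] :
        Fin 2 → MvPolynomial (Fin 2) ℂ) i) := by
  intro i
  fin_cases i
  · simpa using (hG.mul ((hasAlgCoeffs_X 1).pow 2)).mul ((hasAlgCoeffs_prod_X_sub_C ha).pderiv 0)
  · simpa using hG

/-- The differential of `−T`. [folklore] -/
theorem formD_neg (T : MvPolynomial (Fin 2) ℂ) : formD (-T) = -formD T := by
  funext i; simp [formD]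

end Reduction

/-! ### Reduction of polynomial 1-forms on `Z_a`: the induction -/

section Induction

variable {a : Fin r → ℂ} {a' : Fin r → 𝕂}

/-- The `aᵢ` are algebraic (they come from `ℚ̄`). [folklore] -/
theorem isAlgebraic_of_coe_eq (haa : ∀ i, (a' i : ℂ) = a i) (i : Fin r) : IsAlgebraic ℚ (a i) :=
  haa i ▸ mem_algebraicClosure_iff.1 (a' i).2

/-- `ι p = ∏ (x − aᵢ)`. [folklore] -/
theorem iota_p (haa : ∀ i, (a' i : ℂ) = a i) :
    ι (∏ i, (Polynomial.X - Polynomial.C (a' i))) =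
      (∏ i, (X 0 - C (a i)) : MvPolynomial (Fin 2) ℂ) := by
  rw [iota_prod_X_sub_C]
  exact Finset.prod_congr rfl fun i _ => by rw [haa]

/-- `ι pᵢ = Pᵢ = ∏_{j ≠ i} (x − aⱼ)`. [folklore] -/
theorem iota_p_erase (haa : ∀ i, (a' i : ℂ) = a i) (i : Fin r) :
    ι (∏ j ∈ Finset.univ.erase i, (Polynomial.X - Polynomial.C (a' j))) =
      (∏ j ∈ Finset.univ.erase i, (X 0 - C (a j)) : MvPolynomial (Fin 2) ℂ) := by
  rw [iota_prod_X_sub_C]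
  exact Finset.prod_congr rfl fun j _ => by rw [haa]

/-- **Level `0`: `f(x) dx` is exact.** [folklore] -/
theorem red_iota (f : 𝕂[X]) : Red[a] (ι f) := by
  obtain ⟨F, hF⟩ := exists_derivative_eq f
  refine ⟨0, ι F, 0, fun _ => isAlgebraic_zero, hasAlgCoeffs_iota F,
    fun i => by simpa using (hasAlgCoeffs_zero (n := 2)), VanishesOn.zero _, ?_⟩
  have hD : formD (ι F) = ![ι f, 0] := by
    funext i
    fin_cases i
    · show pderiv 0 (ι F) = ι f
      rw [pderiv_zero_iota, hF]
    · show pderiv 1 (ι F) = 0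
      rw [pderiv_one_iota]
  rw [hD, add_zero, vec2_eq_iff]
  refine ⟨?_, ?_⟩
  · rw [Pi.add_apply, (sum_smul_vec_apply _ _).1]; simp
  · rw [Pi.add_apply, (sum_smul_vec_apply _ _).2]; simp

/-- **Level `1`, small degree: Lagrange.** For `deg s < r`,
`s(x) y dx = Σᵢ cᵢ · y Pᵢ dx` with `cᵢ = s(aᵢ)/p′(aᵢ) ∈ ℚ̄` (the residues). [folklore] -/
theorem red_iota_mul_X_of_degree_lt (haa : ∀ i, (a' i : ℂ) = a i)
    (hinj : Function.Injective a') (s : 𝕂[X]) (hs : s.degree < r) : Red[a] (ι s * X 1) := by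
  obtain ⟨c', hc'⟩ := exists_eq_sum_C_mul_prod_erase hinj s hs
  refine ⟨fun i => (c' i : ℂ), 0, 0, fun i => mem_algebraicClosure_iff.1 (c' i).2,
    hasAlgCoeffs_zero, fun i => by simpa using (hasAlgCoeffs_zero (n := 2)), VanishesOn.zero _,
    ?_⟩
  have hs' : ι s * X 1 =
      ∑ i, (c' i : ℂ) • (X 1 * ∏ j ∈ Finset.univ.erase i, (X 0 - C (a j)) :
        MvPolynomial (Fin 2) ℂ) := by
    rw [hc', map_sum, Finset.sum_mul]
    refine Finset.sum_congr rfl fun i _ => ?_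
    rw [map_mul, iota_C, iota_p_erase haa, smul_eq_C_mul]
    ring
  rw [formD_zero, add_zero, add_zero, hs', vec2_eq_iff]
  refine ⟨?_, ?_⟩
  · rw [(sum_smul_vec_apply _ _).1]; simp
  · rw [(sum_smul_vec_apply _ _).2]; simp

/-- **Lowering along `y p(x) = 1`**: `p(x) q(x) yᵇ⁺¹ dx ≡ q(x) yᵇ dx` on `Z_a`. [folklore] -/
theorem red_iota_p_mul (haa : ∀ i, (a' i : ℂ) = a i) {b : ℕ} {q : 𝕂[X]}
    (h : Red[a] (ι q * X 1 ^ b)) :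
    Red[a] (ι ((∏ i, (Polynomial.X - Polynomial.C (a' i))) * q) * X 1 ^ (b + 1)) := by
  refine red_congr h ((hasAlgCoeffs_iota _).mul ((hasAlgCoeffs_X 1).pow _))
    ((hasAlgCoeffs_iota _).mul ((hasAlgCoeffs_X 1).pow _)) fun z hz => ?_
  rw [mem_points_puncturedLine_iff] at hz
  have e1 : eval z (ι (∏ i, (Polynomial.X - Polynomial.C (a' i)))) = ∏ i, (z 0 - a i) := by
    rw [iota_p haa, eval_prod_X_sub_C]
  simp only [map_mul, map_pow, eval_X, e1]
  linear_combination (eval z (ι q) * z 1 ^ b) * hz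

/-- **Lowering the order of the pole: exactness.** From
`d(h(x) yᵏ⁺¹) = h′ yᵏ⁺¹ dx + (k+1) h yᵏ dy` and `dy ≡ −y² p′ dx`:
`(k+1) · h p′ yᵏ⁺² dx ≡ h′ yᵏ⁺¹ dx − d(h yᵏ⁺¹)`. [folklore] -/
theorem red_iota_mul_derivative (haa : ∀ i, (a' i : ℂ) = a i) (k : ℕ) (h : 𝕂[X])
    (ih : Red[a] (ι (Polynomial.derivative h) * X 1 ^ (k + 1))) :
    Red[a] (ι (h * Polynomial.derivative (∏ i, (Polynomial.X - Polynomial.C (a' i)))) *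
      X 1 ^ (k + 1 + 1)) := by
  have ha := isAlgebraic_of_coe_eq haa
  have hdP : pderiv 0 (∏ i, (X 0 - C (a i)) : MvPolynomial (Fin 2) ℂ) =
      ι (Polynomial.derivative (∏ i, (Polynomial.X - Polynomial.C (a' i)))) := by
    rw [← iota_p haa, pderiv_zero_iota]
  have hT : HasAlgCoeffs (ι h * X 1 ^ (k + 1)) :=
    (hasAlgCoeffs_iota h).mul ((hasAlgCoeffs_X 1).pow _)
  have hm0 : ((k : ℂ) + 1) ≠ 0 := Nat.cast_add_one_ne_zero k
  have hm : IsAlgebraic ℚ ((k : ℂ) + 1) := by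
    exact_mod_cast isAlgebraic_nat (R := ℚ) (A := ℂ) (k + 1)
  have hG : HasAlgCoeffs (C ((k : ℂ) + 1) * (ι h * X 1 ^ k)) :=
    (hasAlgCoeffs_C hm).mul ((hasAlgCoeffs_iota h).mul ((hasAlgCoeffs_X 1).pow _))
  have hT0 : pderiv 0 (ι h * X 1 ^ (k + 1)) = ι (Polynomial.derivative h) * X 1 ^ (k + 1) := by
    rw [Derivation.leibniz, Derivation.leibniz_pow, pderiv_X_of_ne (by decide),
      pderiv_zero_iota]
    simp [mul_comm]
  have hT1 : pderiv 1 (ι h * X 1 ^ (k + 1)) = C ((k : ℂ) + 1) * (ι h * X 1 ^ k) := by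
    rw [Derivation.leibniz, Derivation.leibniz_pow, pderiv_X_self, pderiv_one_iota]
    simp only [add_tsub_cancel_right, smul_eq_mul, mul_one, nsmul_eq_mul,
      map_add, map_one, map_natCast, Nat.cast_add, Nat.cast_one]
    ring
  have hformD : formD (ι h * X 1 ^ (k + 1)) =
      ![ι (Polynomial.derivative h) * X 1 ^ (k + 1), C ((k : ℂ) + 1) * (ι h * X 1 ^ k)] := by
    funext i
    fin_cases i
    · simpa [formD] using hT0
    · simpa [formD] using hT1
  refine red_of_smul_eq ih hm0 hm hT.neg (hasAlgCoeffs_dy ha hG)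
    (vanishesOn_puncturedLine_dy a _) ?_
  rw [formD_neg, hformD, vec2_eq_iff]
  constructor
  · simp [hdP, map_mul, smul_eq_C_mul]
    ring
  · simp

/-- **The induction step `b → b + 1`**: divide by `p`, then Lagrange (`b = 0`) or Bézout and
exactness (`b ≥ 1`). [folklore] -/
theorem red_succ (haa : ∀ i, (a' i : ℂ) = a i) (hinj : Function.Injective a') (b : ℕ)
    (ih : ∀ f : 𝕂[X], Red[a] (ι f * X 1 ^ b)) (f : 𝕂[X]) : Red[a] (ι f * X 1 ^ (b + 1)) := by
  have hmonic : (∏ i, (Polynomial.X - Polynomial.C (a' i))).Monic :=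
    Polynomial.monic_prod_of_monic _ _ fun i _ => Polynomial.monic_X_sub_C (a' i)
  have hdiv := Polynomial.modByMonic_add_div f (∏ i, (Polynomial.X - Polynomial.C (a' i)))
  have hdeg : (f %ₘ ∏ i, (Polynomial.X - Polynomial.C (a' i))).degree < r := by
    have h1 := Polynomial.degree_modByMonic_lt f hmonic
    have h2 : (∏ i, (Polynomial.X - Polynomial.C (a' i))).degree = (r : WithBot ℕ) := by
      rw [Polynomial.degree_eq_natDegree hmonic.ne_zero,
        Polynomial.natDegree_finsetProd_X_sub_C_eq_card]
      simp
    rwa [h2] at h1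
  have hsplit : ι f * X 1 ^ (b + 1) =
      ι (f %ₘ ∏ i, (Polynomial.X - Polynomial.C (a' i))) * X 1 ^ (b + 1) +
      ι ((∏ i, (Polynomial.X - Polynomial.C (a' i))) *
        (f /ₘ ∏ i, (Polynomial.X - Polynomial.C (a' i)))) * X 1 ^ (b + 1) := by
    conv_lhs => rw [← hdiv]
    rw [map_add, add_mul]
  rw [hsplit]
  refine red_add ?_ (red_iota_p_mul haa (ih _))
  cases b with
  | zero => simpa using red_iota_mul_X_of_degree_lt haa hinj _ hdeg
  | succ k =>
    obtain ⟨u, v, huv⟩ := exists_bezout_prod_X_sub_C hinj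
    have hs : f %ₘ ∏ i, (Polynomial.X - Polynomial.C (a' i)) =
        (∏ i, (Polynomial.X - Polynomial.C (a' i))) *
          ((f %ₘ ∏ i, (Polynomial.X - Polynomial.C (a' i))) * u) +
        ((f %ₘ ∏ i, (Polynomial.X - Polynomial.C (a' i))) * v) *
          Polynomial.derivative (∏ i, (Polynomial.X - Polynomial.C (a' i))) := by
      linear_combination (-(f %ₘ ∏ i, (Polynomial.X - Polynomial.C (a' i)))) * huv
    rw [hs, map_add, add_mul]
    exact red_add (red_iota_p_mul haa (ih _)) (red_iota_mul_derivative haa k _ (ih _))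

/-- **Every `f(x) yᵇ dx`, `f ∈ ℚ̄[X]`, reduces.** [folklore] -/
theorem red_iota_mul_X_pow (haa : ∀ i, (a' i : ℂ) = a i) (hinj : Function.Injective a')
    (b : ℕ) : ∀ f : 𝕂[X], Red[a] (ι f * X 1 ^ b) := by
  induction b with
  | zero => intro f; simpa using red_iota (a := a) f
  | succ b ih => exact red_succ haa hinj b ih

/-- **Every `g dx`, `g ∈ ℚ̄[x, y]`, reduces** (monomial by monomial). [folklore] -/
theorem red_of_hasAlgCoeffs (haa : ∀ i, (a' i : ℂ) = a i) (hinj : Function.Injective a')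
    (g : MvPolynomial (Fin 2) ℂ) (hg : HasAlgCoeffs g) : Red[a] g := by
  classical
  rw [as_sum g]
  refine red_sum _ _ fun d _ => ?_
  have hm : monomial d (coeff d g) = C (coeff d g) * (ι (Polynomial.X ^ (d 0)) * X 1 ^ (d 1)) := by
    rw [map_pow, iota_X, monomial_eq, Finsupp.prod_pow, Fin.prod_univ_two]
  rw [hm]
  exact red_C_mul (hg d) (red_iota_mul_X_pow haa hinj _ _)

/-- **Reduction of a polynomial 1-form on `Z_a`** (`H¹_dR(𝔸¹ ∖ {aᵢ})` is spanned by the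
`dx/(x − aᵢ)`): `ω₀ dx + ω₁ dy = Σᵢ cᵢ · y Pᵢ dx + dQ + ν` with `cᵢ ∈ ℚ̄`, `Q ∈ ℚ̄[x, y]` and `ν`
over `ℚ̄` vanishing on `Z_a`. [cite: HuberWustholz2022, §3.3.1 (pp. 42–43)] -/
theorem exists_reduction_form_punctured (haa : ∀ i, (a' i : ℂ) = a i)
    (hinj : Function.Injective a') (ω : Fin 2 → MvPolynomial (Fin 2) ℂ)
    (hω : ∀ i, HasAlgCoeffs (ω i)) :
    ∃ (c : Fin r → ℂ) (Q : MvPolynomial (Fin 2) ℂ) (ν : Fin 2 → MvPolynomial (Fin 2) ℂ),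
      (∀ i, IsAlgebraic ℚ (c i)) ∧ HasAlgCoeffs Q ∧ (∀ i, HasAlgCoeffs (ν i)) ∧
        VanishesOn (ZP a) ν ∧
        ω = ∑ i, c i • (![X 1 * ∏ j ∈ Finset.univ.erase i, (X 0 - C (a j)), 0] :
          Fin 2 → MvPolynomial (Fin 2) ℂ) + formD Q + ν := by
  have ha := isAlgebraic_of_coe_eq haa
  have hW := hasAlgCoeffs_dy ha (hω 1)
  have hW0 : HasAlgCoeffs (ω 1 * X 1 ^ 2 *
      pderiv 0 (∏ i, (X 0 - C (a i)) : MvPolynomial (Fin 2) ℂ)) := by simpa using hW 0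
  obtain ⟨c, Q, ν, hc, hQ, hν, hv, he⟩ := red_of_hasAlgCoeffs haa hinj
    (ω 0 - ω 1 * X 1 ^ 2 * pderiv 0 (∏ i, (X 0 - C (a i)) : MvPolynomial (Fin 2) ℂ))
    ((hω 0).sub hW0)
  refine ⟨c, Q, ν + ![ω 1 * X 1 ^ 2 * pderiv 0 (∏ i, (X 0 - C (a i)) : MvPolynomial (Fin 2) ℂ),
    ω 1], hc, hQ, fun i => ?_, hv.add (vanishesOn_puncturedLine_dy a (ω 1)), ?_⟩
  · fin_cases i
    · simpa using (hν 0).add hW0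
    · simpa using (hν 1).add (hω 1)
  · have hω' : ω = (![ω 0 - ω 1 * X 1 ^ 2 *
        pderiv 0 (∏ i, (X 0 - C (a i)) : MvPolynomial (Fin 2) ℂ), 0] :
          Fin 2 → MvPolynomial (Fin 2) ℂ) +
        ![ω 1 * X 1 ^ 2 * pderiv 0 (∏ i, (X 0 - C (a i)) : MvPolynomial (Fin 2) ℂ), ω 1] := by
      rw [vec2_eq_iff]; simp
    calc ω = _ := hω'
      _ = ∑ i, c i • (![X 1 * ∏ j ∈ Finset.univ.erase i, (X 0 - C (a j)), 0] :
            Fin 2 → MvPolynomial (Fin 2) ℂ) + formD Q + ν +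
          ![ω 1 * X 1 ^ 2 * pderiv 0 (∏ i, (X 0 - C (a i)) : MvPolynomial (Fin 2) ℂ), ω 1] := by
        rw [he]
      _ = _ := by abel

end Induction

/-! ### Linearity of symbols in the form (iterated (R1)) -/

section Symbols

/-- The span is closed under finite sums. [folklore] -/
theorem span_finsetSum {ι' : Type*} (S : Finset ι') (v : ι' → (PeriodSymbol →₀ ℂ))
    (h : ∀ i ∈ S, InSpanRel (v i)) : InSpanRel (∑ i ∈ S, v i) := by
  classical
  induction S using Finset.induction_on with
  | empty => simpa using span_zero
  | insert i S hi ih =>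
    rw [Finset.sum_insert hi]
    exact span_add (h i (Finset.mem_insert_self i S)) (ih fun j hj => h j (Finset.mem_insert_of_mem hj))

/-- Sums of forms over `ℚ̄` are over `ℚ̄`, componentwise. [folklore] -/
theorem hasAlgCoeffs_sum_apply {n : ℕ} {ι' : Type*} (S : Finset ι')
    (ω : ι' → Fin n → MvPolynomial (Fin n) ℂ) (h : ∀ i k, HasAlgCoeffs (ω i k)) (k : Fin n) :
    HasAlgCoeffs ((∑ i ∈ S, ω i) k) := by
  rw [Finset.sum_apply]
  exact hasAlgCoeffs_finsetSum _ _ fun i _ => h i k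

/-- **Iterated (R1a)**: `(Z, Σᵢ ωᵢ, γ) − Σᵢ (Z, ωᵢ, γ)` lies in the span. [folklore] -/
theorem span_single_finsetSum (Z : CurveData) (hZ : Z.IsSmoothAffineCurve) (γ : CurvePath Z)
    {ι' : Type*} (S : Finset ι') (ω : ι' → Fin Z.n → MvPolynomial (Fin Z.n) ℂ)
    (h : ∀ i k, HasAlgCoeffs (ω i k)) :
    InSpanRel (Finsupp.single (⟨Z, hZ, ∑ i ∈ S, ω i, hasAlgCoeffs_sum_apply S ω h, γ⟩ :
        PeriodSymbol) (1 : ℂ) -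
      ∑ i ∈ S, Finsupp.single (⟨Z, hZ, ω i, h i, γ⟩ : PeriodSymbol) (1 : ℂ)) := by
  classical
  induction S using Finset.induction_on with
  | empty =>
    have e : ∑ i ∈ (∅ : Finset ι'), Finsupp.single (⟨Z, hZ, ω i, h i, γ⟩ : PeriodSymbol) (1 : ℂ) =
        0 := Finset.sum_empty
    rw [e, sub_zero]
    refine span_of_rel (IsElementaryRelation.vanish Z hZ γ _ _ fun z _ v _ => ?_)
    simp
  | insert j S hj ih =>
    have hω : (∑ i ∈ insert j S, ω i) = ω j + ∑ i ∈ S, ω i := Finset.sum_insert hj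
    have r₁ := IsElementaryRelation.add Z hZ γ (∑ i ∈ insert j S, ω i) (ω j) (∑ i ∈ S, ω i)
      (hasAlgCoeffs_sum_apply _ ω h) (h j) (hasAlgCoeffs_sum_apply S ω h) hω
    obtain ⟨k, ρ, a, hρ, ha, hsum⟩ := span_add (span_of_rel r₁) ih
    refine ⟨k, ρ, a, hρ, ha, ?_⟩
    have e : ∑ i ∈ insert j S, Finsupp.single (⟨Z, hZ, ω i, h i, γ⟩ : PeriodSymbol) (1 : ℂ) =
        Finsupp.single (⟨Z, hZ, ω j, h j, γ⟩ : PeriodSymbol) (1 : ℂ) +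
          ∑ i ∈ S, Finsupp.single (⟨Z, hZ, ω i, h i, γ⟩ : PeriodSymbol) (1 : ℂ) :=
      Finset.sum_insert hj
    rw [← hsum, e]
    abel

/-- **Iterated (R1)**: `(Z, Σᵢ cᵢ ωᵢ, γ) − Σᵢ cᵢ (Z, ωᵢ, γ)` lies in the span, for `cᵢ ∈ ℚ̄`.
[folklore] -/
theorem span_single_sum_smul (Z : CurveData) (hZ : Z.IsSmoothAffineCurve) (γ : CurvePath Z)
    {ι' : Type*} (S : Finset ι') (ω : ι' → Fin Z.n → MvPolynomial (Fin Z.n) ℂ)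
    (h : ∀ i k, HasAlgCoeffs (ω i k)) (c : ι' → ℂ) (hc : ∀ i, IsAlgebraic ℚ (c i))
    (hS : ∀ k, HasAlgCoeffs ((∑ i ∈ S, c i • ω i) k)) :
    InSpanRel (Finsupp.single (⟨Z, hZ, ∑ i ∈ S, c i • ω i, hS, γ⟩ : PeriodSymbol) (1 : ℂ) -
      ∑ i ∈ S, c i • Finsupp.single (⟨Z, hZ, ω i, h i, γ⟩ : PeriodSymbol) (1 : ℂ)) := by
  have h' : ∀ i k, HasAlgCoeffs ((c i • ω i) k) := fun i k => (h i k).smul (hc i)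
  have h₁ := span_single_finsetSum Z hZ γ S (fun i => c i • ω i) h'
  have h₂ : InSpanRel (∑ i ∈ S, (Finsupp.single (⟨Z, hZ, c i • ω i, h' i, γ⟩ : PeriodSymbol)
      (1 : ℂ) - c i • Finsupp.single (⟨Z, hZ, ω i, h i, γ⟩ : PeriodSymbol) (1 : ℂ))) :=
    span_finsetSum S _ fun i _ =>
      span_of_rel (IsElementaryRelation.smul Z hZ γ (c i) (hc i) (ω i) (c i • ω i) (h i) (h' i) rfl)
  obtain ⟨k, ρ, a, hρ, ha, hsum⟩ := span_add h₁ h₂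
  refine ⟨k, ρ, a, hρ, ha, ?_⟩
  rw [PeriodSymbol.mk_eq_mk hZ hS (hasAlgCoeffs_sum_apply S _ h') γ rfl, ← hsum,
    Finset.sum_sub_distrib]
  abel

end Symbols

/-! ### From `Z_a` to `𝔾ₘ`: functoriality along `fᵢ = (x − aᵢ, y Pᵢ)` -/

section Transfer

variable {a : Fin r → ℂ}

/-- The basic forms `y Pᵢ dx` are over `ℚ̄`. [folklore] -/
theorem hasAlgCoeffs_basicForm (ha : ∀ i, IsAlgebraic ℚ (a i)) (i : Fin r) :
    ∀ k, HasAlgCoeffs ((![X 1 * ∏ j ∈ Finset.univ.erase i, (X 0 - C (a j)), 0] :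
      Fin 2 → MvPolynomial (Fin 2) ℂ) k) := by
  intro k
  fin_cases k
  · simpa using (hasAlgCoeffs_X (n := 2) 1).mul
      (hasAlgCoeffs_finsetProd _ _ fun j _ => (hasAlgCoeffs_X 0).sub (hasAlgCoeffs_C (ha j)))
  · simpa using (hasAlgCoeffs_zero (n := 2))

/-- **(R4) along `fᵢ = (x − aᵢ, y Pᵢ) : Z_a → 𝔾ₘ`**, `fᵢ^*(y dx) = y Pᵢ dx`: the basic symbol
`(Z_a, y Pᵢ dx, γ)` equals the logarithm-type symbol `(𝔾ₘ, y dx, fᵢ ∘ γ)` modulo an elementary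
relation. [cite: HuberWustholz2022, §13.1 (B) (p. 120)] -/
theorem exists_rel_basicForm_mulGroup (ha : ∀ i, IsAlgebraic ℚ (a i)) (i : Fin r)
    (γ : CurvePath (ZP a)) :
    ∃ γ' : CurvePath (⟨2, 1, ![X 0 * X 1 - 1]⟩ : CurveData),
      (∀ t, γ'.toFun t = ![γ.toFun t 0 - a i,
        γ.toFun t 1 * ∏ j ∈ Finset.univ.erase i, (γ.toFun t 0 - a j)]) ∧
      IsElementaryRelation
        (Finsupp.single (⟨ZP a, isSmoothAffineCurve_puncturedLine ha,
            ![X 1 * ∏ j ∈ Finset.univ.erase i, (X 0 - C (a j)), 0],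
            hasAlgCoeffs_basicForm ha i, γ⟩ : PeriodSymbol) 1 -
          Finsupp.single (⟨⟨2, 1, ![X 0 * X 1 - 1]⟩, isSmoothAffineCurve_mulGroup, ![X 1, 0],
            hasAlgCoeffs_ydx, γ'⟩ : PeriodSymbol) 1) := by
  classical
  -- the map `fᵢ`
  let f : Fin 2 → MvPolynomial (Fin 2) ℂ :=
    ![X 0 - C (a i), X 1 * ∏ j ∈ Finset.univ.erase i, (X 0 - C (a j))]
  have hf : ∀ j, HasAlgCoeffs (f j) := by
    intro j
    fin_cases j
    · simpa [f] using (hasAlgCoeffs_X (n := 2) 0).sub (hasAlgCoeffs_C (ha i))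
    · simpa [f] using (hasAlgCoeffs_X (n := 2) 1).mul
        (hasAlgCoeffs_finsetProd _ _ fun j _ => (hasAlgCoeffs_X 0).sub (hasAlgCoeffs_C (ha j)))
  have hevf : ∀ z : Fin 2 → ℂ, (fun j => eval z (f j)) =
      ![z 0 - a i, z 1 * ∏ j ∈ Finset.univ.erase i, (z 0 - a j)] := by
    intro z
    funext j
    fin_cases j
    · simp [f]
    · simp [f, map_prod]
  have hfZ : ∀ z ∈ (ZP a).points,
      (fun j => eval z (f j)) ∈ (⟨2, 1, ![X 0 * X 1 - 1]⟩ : CurveData).points := by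
    intro z hz
    rw [mem_points_puncturedLine_iff] at hz
    rw [hevf, mem_points_mulGroup_iff]
    simp only [Matrix.cons_val_zero, Matrix.cons_val_one, Matrix.cons_val_fin_one]
    have e : (z 0 - a i) * ∏ j ∈ Finset.univ.erase i, (z 0 - a j) = ∏ j, (z 0 - a j) :=
      Finset.mul_prod_erase (s := Finset.univ) (f := fun j => z 0 - a j) (Finset.mem_univ i)
    rw [mul_left_comm, e, hz]
  have hω : (![X 1 * ∏ j ∈ Finset.univ.erase i, (X 0 - C (a j)), 0] :
      Fin 2 → MvPolynomial (Fin 2) ℂ) = formPullback f ![X 1, 0] := by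
    funext k
    fin_cases k
    · simp [formPullback, f, Fin.sum_univ_two, pderiv_X]
    · simp [formPullback, f, Fin.sum_univ_two, pderiv_X, pderiv_one_prod_X_sub_C]
  let γ' : CurvePath (⟨2, 1, ![X 0 * X 1 - 1]⟩ : CurveData) :=
    { toFun := fun t j => eval (γ.toFun t) (f j)
      contDiffOn := contDiffOn_pi' fun j => contDiffOn_eval_comp γ.contDiffOn (f j)
      mem_points := fun t ht => hfZ _ (γ.mem_points t ht)
      algebraic_zero := fun j => (hf j).isAlgebraic_eval γ.algebraic_zero
      algebraic_one := fun j => (hf j).isAlgebraic_eval γ.algebraic_one }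
  refine ⟨γ', fun t => ?_, ?_⟩
  · show (fun j => eval (γ.toFun t) (f j)) = _
    rw [hevf]
  · exact IsElementaryRelation.pushforward (ZP a) ⟨2, 1, ![X 0 * X 1 - 1]⟩
      (isSmoothAffineCurve_puncturedLine ha) isSmoothAffineCurve_mulGroup f hf hfZ ![X 1, 0]
      hasAlgCoeffs_ydx _ (hasAlgCoeffs_basicForm ha i) hω γ γ' fun t _ => rfl

/-- **Every symbol on `Z_a` is `Σᵢ cᵢ · (𝔾ₘ, y dx, fᵢ ∘ γ) + e · 𝟙` modulo the relations**, with
`cᵢ, e ∈ ℚ̄` (form reduction, (R1)–(R3), then (R4) along the `fᵢ`). [folklore] -/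
theorem exists_transfer_puncturedLine (ha : ∀ i, IsAlgebraic ℚ (a i))
    (hinj : Function.Injective a) (ω : Fin 2 → MvPolynomial (Fin 2) ℂ)
    (hω : ∀ i, HasAlgCoeffs (ω i)) (γ : CurvePath (ZP a)) :
    ∃ (c : Fin r → ℂ) (γ' : Fin r → CurvePath (⟨2, 1, ![X 0 * X 1 - 1]⟩ : CurveData)) (e : ℂ),
      (∀ i, IsAlgebraic ℚ (c i)) ∧ IsAlgebraic ℚ e ∧
      InSpanRel (Finsupp.single (⟨ZP a, isSmoothAffineCurve_puncturedLine ha, ω, hω, γ⟩ :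
          PeriodSymbol) (1 : ℂ) -
        ∑ i, c i • Finsupp.single (⟨⟨2, 1, ![X 0 * X 1 - 1]⟩, isSmoothAffineCurve_mulGroup,
          ![X 1, 0], hasAlgCoeffs_ydx, γ' i⟩ : PeriodSymbol) (1 : ℂ) -
        e • Finsupp.single PeriodSymbol.unit (1 : ℂ)) := by
  classical
  have hZ : (ZP a).IsSmoothAffineCurve := isSmoothAffineCurve_puncturedLine ha
  -- lift `a` to `ℚ̄`
  let a' : Fin r → 𝕂 := fun i => ⟨a i, mem_algebraicClosure_iff.2 (ha i)⟩
  have haa : ∀ i, (a' i : ℂ) = a i := fun i => rfl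
  have hinj' : Function.Injective a' := fun i j hij => hinj (by
    have := congrArg Subtype.val hij
    exact this)
  obtain ⟨c, Q, ν, hc, hQ, hν, hv, he⟩ := exists_reduction_form_punctured haa hinj' ω hω
  choose γ' hγ' hrel using fun i => exists_rel_basicForm_mulGroup ha i γ
  refine ⟨c, γ', eval (γ.toFun 1) Q - eval (γ.toFun 0) Q, hc,
    (hQ.isAlgebraic_eval γ.algebraic_one).sub (hQ.isAlgebraic_eval γ.algebraic_zero), ?_⟩
  have hb : ∀ i k, HasAlgCoeffs ((![X 1 * ∏ j ∈ Finset.univ.erase i, (X 0 - C (a j)), 0] :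
      Fin 2 → MvPolynomial (Fin 2) ℂ) k) := hasAlgCoeffs_basicForm ha
  have hS : ∀ k, HasAlgCoeffs ((∑ i, c i • (![X 1 * ∏ j ∈ Finset.univ.erase i, (X 0 - C (a j)),
      0] : Fin 2 → MvPolynomial (Fin 2) ℂ)) k) :=
    fun k => hasAlgCoeffs_sum_apply _ _ (fun i k => (hb i k).smul (hc i)) k
  have hdQ : ∀ k, HasAlgCoeffs (formD Q k) := hQ.formD
  have h₂alg : ∀ k, HasAlgCoeffs ((∑ i, c i • (![X 1 * ∏ j ∈ Finset.univ.erase i,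
      (X 0 - C (a j)), 0] : Fin 2 → MvPolynomial (Fin 2) ℂ) + formD Q) k) :=
    fun k => (hS k).add (hdQ k)
  have h₃alg : ∀ k, HasAlgCoeffs ((∑ i, c i • (![X 1 * ∏ j ∈ Finset.univ.erase i,
      (X 0 - C (a j)), 0] : Fin 2 → MvPolynomial (Fin 2) ℂ) + formD Q + ν) k) :=
    fun k => (h₂alg k).add (hν k)
  have r₁ := IsElementaryRelation.add _ hZ γ _ _ _ h₃alg h₂alg hν rfl
  have r₂ := IsElementaryRelation.add _ hZ γ _ _ _ h₂alg hS hdQ rfl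
  have r₃ := span_single_sum_smul (ZP a) hZ γ Finset.univ _ hb c hc hS
  have r₄ := IsElementaryRelation.exact _ hZ γ Q hQ _ hdQ rfl
  have r₅ := IsElementaryRelation.vanish _ hZ γ ν hν hv
  have r₆ : InSpanRel (∑ i, c i • (Finsupp.single (⟨ZP a, hZ,
      ![X 1 * ∏ j ∈ Finset.univ.erase i, (X 0 - C (a j)), 0], hb i, γ⟩ : PeriodSymbol) (1 : ℂ) -
      Finsupp.single (⟨⟨2, 1, ![X 0 * X 1 - 1]⟩, isSmoothAffineCurve_mulGroup, ![X 1, 0],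
        hasAlgCoeffs_ydx, γ' i⟩ : PeriodSymbol) (1 : ℂ))) :=
    span_finsetSum _ _ fun i _ => span_smul (hc i) (span_of_rel (hrel i))
  obtain ⟨k, ρ, cf, hρ, hcf, hsum⟩ := span_add (span_add (span_add (span_add (span_add
    (span_of_rel r₁) (span_of_rel r₂)) r₃) (span_of_rel r₄)) (span_of_rel r₅)) r₆
  refine ⟨k, ρ, cf, hρ, hcf, ?_⟩
  rw [PeriodSymbol.mk_eq_mk hZ hω h₃alg γ he, ← hsum]
  simp only [smul_sub, Finset.sum_sub_distrib]
  abel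

end Transfer

/-! ### Transfer of the theorem along symbolwise reductions to finitely many symbols -/

section Assembly

/-- **Transfer along symbolwise relations to combinations.** If every symbol `s` of `c` is,
modulo the span of the relations, a finite `ℚ̄`-combination `V s` of symbols for which a
version of the theorem is known (all combinations with algebraic coefficients supported on
symbols satisfying `P`), then the theorem holds for `c`. [folklore] -/
theorem span_of_transfer_finsupp (c : PeriodSymbol →₀ ℂ) (hc : ∀ s, IsAlgebraic ℚ (c s))
    (V : PeriodSymbol → (PeriodSymbol →₀ ℂ))
    (hValg : ∀ s ∈ c.support, ∀ t, IsAlgebraic ℚ (V s t))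
    (hVrel : ∀ s ∈ c.support, InSpanRel (Finsupp.single s 1 - V s))
    (P : PeriodSymbol → Prop) (hP : ∀ s ∈ c.support, ∀ t ∈ (V s).support, P t)
    (htarget : ∀ c' : PeriodSymbol →₀ ℂ, (∀ s, IsAlgebraic ℚ (c' s)) → (∀ s ∈ c'.support, P s) →
      evalCombination c' = 0 → InSpanRel c')
    (h0 : evalCombination c = 0) : InSpanRel c := by
  classical
  set c' : PeriodSymbol →₀ ℂ := ∑ s ∈ c.support, c s • V s with hc'
  have hdiff : InSpanRel (∑ s ∈ c.support, c s • (Finsupp.single s (1 : ℂ) - V s)) :=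
    span_finsetSum _ _ fun s hs => span_smul (hc s) (hVrel s hs)
  have hcc' : c - c' = ∑ s ∈ c.support, c s • (Finsupp.single s (1 : ℂ) - V s) := by
    have hc_eq : c = ∑ s ∈ c.support, c s • Finsupp.single s (1 : ℂ) := by
      conv_lhs => rw [← Finsupp.sum_single c]
      simp only [Finsupp.sum, Finsupp.smul_single_one]
    conv_lhs => rw [hc_eq, hc']
    rw [← Finset.sum_sub_distrib]
    exact Finset.sum_congr rfl fun s _ => by rw [smul_sub]
  rw [← hcc'] at hdiff
  have hc'alg : ∀ t, IsAlgebraic ℚ (c' t) := by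
    intro t
    rw [hc', Finsupp.finsetSum_apply]
    refine isAlgebraic_finsetSum _ _ fun s hs => ?_
    rw [Finsupp.smul_apply, smul_eq_mul]
    exact (hc s).mul (hValg s hs t)
  have hc'supp : ∀ t ∈ c'.support, P t := by
    intro t ht
    have ht' : t ∈ (c.support).biUnion fun s => (c s • V s).support :=
      Finsupp.support_finsetSum ht
    obtain ⟨s, hs, hmem⟩ := Finset.mem_biUnion.1 ht'
    exact hP s hs t (Finsupp.support_smul hmem)
  have hc'ev : evalCombination c' = 0 := by
    obtain ⟨k₁, ρ₁, a₁, hρ₁, -, he₁⟩ := hdiff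
    have h := evalCombination_eq_zero_of_isElementaryRelation ρ₁ a₁ hρ₁
    rw [← he₁, sub_eq_add_neg, evalCombination_add, ← neg_one_smul ℂ c', evalCombination_smul,
      h0] at h
    linear_combination -h
  obtain ⟨k, ρ, a, hρ, ha, he⟩ := span_add hdiff (htarget c' hc'alg hc'supp hc'ev)
  exact ⟨k, ρ, a, hρ, ha, by rw [← he, sub_add_cancel]⟩

end Assembly

/-! ### The theorem -/

section Main

/-- Values of `single x 1` are algebraic (`0` or `1`). [folklore] -/
theorem isAlgebraic_single_one_apply (x t : PeriodSymbol) :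
    IsAlgebraic ℚ ((Finsupp.single x (1 : ℂ)) t) := by
  classical
  rw [Finsupp.single_apply]
  split_ifs
  · exact isAlgebraic_one
  · exact isAlgebraic_zero

/-- **Huber–Wüstholz, Theorem 13.3 (2), in genus `0` — from Baker's theorem.** A vanishing
`ℚ̄`-linear combination of period symbols living on punctured lines
`Z_a = {y ∏ᵢ (x − aᵢ) = 1} ⊂ 𝔸²` (`a : Fin r → ℚ̄` injective, any `r`; these are the smooth affine
curves of genus `0` over `ℚ̄`, `𝔸¹ ∖ {a₁, …, a_r}`, in their standard embedding), on
`𝔾ₘ = {xy = 1}` and on `𝔸¹`, with arbitrary `C¹` paths with algebraic end points, is a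
`ℚ̄`-linear combination of the elementary relations (R1)–(R5). The periods in question are the
`ℚ̄`-combinations of `1` and of logarithms of algebraic numbers (`∫_γ dx/(x − aᵢ)`); the only
transcendence input is Baker's theorem (`baker_holds`, proved in the tree), as the book says of the
1-motives `[ℤʳ → 𝔾ₘˢ]` (Rem. 15.11: "This is precisely Baker's Theorem").
[cite: HuberWustholz2022, Thm. 13.3 (2) (p. 121), §3.3.1 (pp. 42–43), Rem. 15.11 (p. 151)] -/
theorem huberWustholzCurvePeriods_of_puncturedLine (c : PeriodSymbol →₀ ℂ)
    (hc : ∀ s, IsAlgebraic ℚ (c s))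
    (hsupp : ∀ s ∈ c.support,
      (∃ (r : ℕ) (a : Fin r → ℂ), Function.Injective a ∧ (∀ i, IsAlgebraic ℚ (a i)) ∧
        s.Z = ZP a) ∨
      s.Z = (⟨2, 1, ![X 0 * X 1 - 1]⟩ : CurveData) ∨ s.Z = CurveData.affineLine)
    (h0 : evalCombination c = 0) :
    ∃ (k : ℕ) (ρ : Fin k → (PeriodSymbol →₀ ℂ)) (a : Fin k → ℂ),
      (∀ l, IsElementaryRelation (ρ l)) ∧ (∀ l, IsAlgebraic ℚ (a l)) ∧ c = ∑ l, a l • ρ l := by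
  classical
  have key : ∀ s : PeriodSymbol, ∃ V : PeriodSymbol →₀ ℂ, s ∈ c.support →
      ((∀ t, IsAlgebraic ℚ (V t)) ∧ InSpanRel (Finsupp.single s 1 - V) ∧
        (∀ t ∈ V.support,
          t.Z = (⟨2, 1, ![X 0 * X 1 - 1]⟩ : CurveData) ∨ t.Z = CurveData.affineLine)) := by
    intro s
    by_cases hs : s ∈ c.support
    · rcases hsupp s hs with ⟨r, a, hinj, ha, hsZ⟩ | hGm | hA
      · obtain ⟨Z, hZ, ω, hω, γ⟩ := s
        dsimp only at hsZ
        subst hsZ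
        obtain rfl : hZ = isSmoothAffineCurve_puncturedLine ha := rfl
        obtain ⟨cf, γ', e, hcf, he, hrel⟩ := exists_transfer_puncturedLine ha hinj ω hω γ
        refine ⟨∑ i, cf i • Finsupp.single (⟨⟨2, 1, ![X 0 * X 1 - 1]⟩,
            isSmoothAffineCurve_mulGroup, ![X 1, 0], hasAlgCoeffs_ydx, γ' i⟩ : PeriodSymbol)
            (1 : ℂ) + e • Finsupp.single PeriodSymbol.unit (1 : ℂ), fun _ => ⟨?_, ?_, ?_⟩⟩
        · intro t
          rw [Finsupp.add_apply, Finsupp.finsetSum_apply, Finsupp.smul_apply, smul_eq_mul]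
          refine (isAlgebraic_finsetSum _ _ fun i _ => ?_).add
            (he.mul (isAlgebraic_single_one_apply _ _))
          rw [Finsupp.smul_apply, smul_eq_mul]
          exact (hcf i).mul (isAlgebraic_single_one_apply _ _)
        · obtain ⟨k, ρ, b, hρ, hb, hsum⟩ := hrel
          exact ⟨k, ρ, b, hρ, hb, by rw [← hsum]; abel⟩
        · intro t ht
          rcases Finset.mem_union.1 (Finsupp.support_add ht) with h1 | h2
          · obtain ⟨i, _, hi⟩ := Finset.mem_biUnion.1 (Finsupp.support_finsetSum h1)
            have h3 := (Finsupp.mem_support_single _ _ _).1 (Finsupp.support_smul hi)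
            exact Or.inl (by rw [h3.1])
          · have h3 := (Finsupp.mem_support_single _ _ _).1 (Finsupp.support_smul h2)
            exact Or.inr (by rw [h3.1]; rfl)
      · refine ⟨Finsupp.single s 1, fun _ => ⟨fun t => isAlgebraic_single_one_apply _ _,
          by rw [sub_self]; exact span_zero, fun t ht => ?_⟩⟩
        have h3 := (Finsupp.mem_support_single _ _ _).1 ht
        exact Or.inl (by rw [h3.1, hGm])
      · refine ⟨Finsupp.single s 1, fun _ => ⟨fun t => isAlgebraic_single_one_apply _ _,
          by rw [sub_self]; exact span_zero, fun t ht => ?_⟩⟩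
        have h3 := (Finsupp.mem_support_single _ _ _).1 ht
        exact Or.inr (by rw [h3.1, hA])
    · exact ⟨0, fun h => (hs h).elim⟩
  choose V hV using key
  exact span_of_transfer_finsupp c hc V (fun s hs => (hV s hs).1) (fun s hs => (hV s hs).2.1)
    (fun t => t.Z = (⟨2, 1, ![X 0 * X 1 - 1]⟩ : CurveData) ∨ t.Z = CurveData.affineLine)
    (fun s hs => (hV s hs).2.2)
    (fun c' hc' hsupp' h0' => huberWustholzCurvePeriods_of_mulGroup_affineLine c' hc' hsupp' h0')
    h0

/-- **… and for every curve polynomially isomorphic to a punctured line, to `𝔾ₘ` or to `𝔸¹`**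
(arbitrary `C¹` paths with algebraic end points; e.g. `y p(x) = 1` for any `p ∈ ℚ̄[x]` with its
distinct roots `aᵢ`, conics minus points, …): transport along the isomorphism by (R4)
(`exists_transport`), then `huberWustholzCurvePeriods_of_puncturedLine`.
[cite: HuberWustholz2022, Thm. 13.3 (2) (p. 121), §13.1 (B) (p. 120)] -/
theorem huberWustholzCurvePeriods_of_iso_puncturedLine (c : PeriodSymbol →₀ ℂ)
    (hc : ∀ s, IsAlgebraic ℚ (c s))
    (hiso : ∀ s ∈ c.support, ∃ Z₀ : CurveData,
      ((∃ (r : ℕ) (a : Fin r → ℂ), Function.Injective a ∧ (∀ i, IsAlgebraic ℚ (a i)) ∧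
          Z₀ = ZP a) ∨
        Z₀ = (⟨2, 1, ![X 0 * X 1 - 1]⟩ : CurveData) ∨ Z₀ = CurveData.affineLine) ∧
      Z₀.IsSmoothAffineCurve ∧
      ∃ (φ : Fin s.Z.n → MvPolynomial (Fin Z₀.n) ℂ) (ψ : Fin Z₀.n → MvPolynomial (Fin s.Z.n) ℂ),
        (∀ j, HasAlgCoeffs (φ j)) ∧ (∀ i, HasAlgCoeffs (ψ i)) ∧
          (∀ x ∈ Z₀.points, (fun j => eval x (φ j)) ∈ s.Z.points) ∧
          (∀ z ∈ s.Z.points, (fun i => eval z (ψ i)) ∈ Z₀.points) ∧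
          (∀ z ∈ s.Z.points, (fun j => eval (fun i => eval z (ψ i)) (φ j)) = z))
    (h0 : evalCombination c = 0) :
    ∃ (k : ℕ) (ρ : Fin k → (PeriodSymbol →₀ ℂ)) (a : Fin k → ℂ),
      (∀ l, IsElementaryRelation (ρ l)) ∧ (∀ l, IsAlgebraic ℚ (a l)) ∧ c = ∑ l, a l • ρ l := by
  classical
  have key : ∀ s : PeriodSymbol, ∃ s₁ : PeriodSymbol, s ∈ c.support →
      (((∃ (r : ℕ) (a : Fin r → ℂ), Function.Injective a ∧ (∀ i, IsAlgebraic ℚ (a i)) ∧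
          s₁.Z = ZP a) ∨
        s₁.Z = (⟨2, 1, ![X 0 * X 1 - 1]⟩ : CurveData) ∨ s₁.Z = CurveData.affineLine) ∧
        IsElementaryRelation (Finsupp.single s₁ 1 - Finsupp.single s 1)) := by
    intro s
    by_cases hs : s ∈ c.support
    · obtain ⟨Z₀, hZ₀, hsm, φ, ψ, hφ, hψ, hφZ, hψZ, hinv⟩ := hiso s hs
      obtain ⟨γ, _, hrel⟩ := exists_transport hsm s.smooth φ hφ hφZ ψ hψ hψZ hinv s.ω
        s.ω_algebraic s.γ
      exact ⟨_, fun _ => ⟨hZ₀, hrel⟩⟩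
    · exact ⟨s, fun h => (hs h).elim⟩
  choose T hT using key
  exact span_of_transfer c hc T (fun s hs => (hT s hs).2)
    (fun s => (∃ (r : ℕ) (a : Fin r → ℂ), Function.Injective a ∧ (∀ i, IsAlgebraic ℚ (a i)) ∧
        s.Z = ZP a) ∨
      s.Z = (⟨2, 1, ![X 0 * X 1 - 1]⟩ : CurveData) ∨ s.Z = CurveData.affineLine)
    (fun s hs => (hT s hs).1)
    (fun c' hc' hsupp h0' => huberWustholzCurvePeriods_of_puncturedLine c' hc' hsupp h0') h0

end Main

end PuncturedLine

end CurvePeriods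

end Literature.NumberTheory.Transcendental

end
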